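import Mathlib.AlgebraicGeometry.EllipticCurve.DivisionPolynomial.Basic
import Mathlib.Tactic.LinearCombination

/-!
# The flex criterion behind the `phisel3` MODEL step: the shifted short model has `B² = 4AC`
# exactly when the shift abscissa is a zero of the `3`-division polynomial
# (cell `b2b-bsdres`, CLASS-CLOSURE instrument builder 4 = seat cc-eng-4, GEN 102)

HONEST FRAMING (cell `b2b-bsdres`, run/shared/lean/b2b/bsd-rank1-residual/, verbatim in every
file): the goal of the cell is to DELETE the COMBINATION-SHAPED residual classes of the
Birch–Swinnerton-Dyer formula for ALL analytic-rank `≤ 1` elliptic curves over `ℚ` — "full BSD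
formula for every rank `≤ 1` curve in class `C`" assembled STRICTLY from published theorems — so
that the rank-`≤ 1` remainder becomes exactly the CONSTRUCTION-SHAPED classes, which are TYPED
(missing-input `Prop`s), NOT attempted. This is not "finishing BSD". THIS FILE is a class-free TOOL
file (pure commutative algebra; every statement closed by `simp only` + `ring` /
`linear_combination`); NOT a Literature fact, NOT a class theorem; it asserts nothing about any
curve, closes no item, books nothing, moves no RESIDUAL-MAP mark. THEOREMS ONLY (no definition).

## What is checked here, and why the instrument needs it

The second-`φ`-descent instrument `phisel3` (`class-closure/eng-4/b24i2/`, design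
`DESIGN-B24-IMPL2-v0.md` §(3)(a), engine `code/phisel3.gp` `ps_model`) starts every row from a
Weierstrass model `[a₁, a₂, a₃, a₄, a₆]` of `W₀` and the tabled abscissa `x₀` of the kernel of the
rational `3`-isogeny (o6-r1's column `xS`), and builds the Cohen–Pazuki model
`y² = x³ + D(ax + b)²` as follows: complete the square (`(2y + a₁x + a₃)² = 4x³ + b₂x² + 2b₄x + b₆`),
scale to the monic model `Y² = X³ + b₂X² + 8b₄X + 16b₆` (`X = 4x`, `Y = 8y + 4a₁x + 4a₃`), shift
`X ↦ X + 4x₀`, obtaining `Y² = X³ + AX² + BX + C` with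
`A = 12x₀ + b₂`, `B = 48x₀² + 8b₂x₀ + 8b₄`, `C = 64x₀³ + 16b₂x₀² + 32b₄x₀ + 16b₆`,
and then ASSERTS `B² = 4AC` ("flex at `X = 0`") before writing `AX² + BX + C = A(X + B/(2A))²`.
The assertion is what makes the row's `xS` load-bearing: this file checks, once and in the kernel,
over an arbitrary commutative ring, that

* `flexCriterion_sub`: the square-completion identity
  `(2y + a₁x + a₃)² − (4x³ + b₂x² + 2b₄x + b₆) = 4·(Weierstrass equation residual)`;
* `flexCriterion_shift`: the monic model equals the shifted form with the displayed `A, B, C`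
  identically in `X` (`16·(4x³ + b₂x² + 2b₄x + b₆) = X³ + AX² + BX + C` at `X = 4x − 4x₀`);
* `flexCriterion_disc`: **`B² − 4AC = −256 · Ψ₃(x₀)`**, where `Ψ₃ = 3x⁴ + b₂x³ + 3b₄x² + 3b₆x + b₈`
  is Mathlib's `3`-division polynomial `WeierstrassCurve.Ψ₃` — so the engine's assertion holds
  EXACTLY when `x₀` is a zero of `Ψ₃`, i.e. the abscissa of a point of order `3` (for a curve with a
  rational `3`-isogeny: of the kernel), and fails otherwise; in particular the assertion is a
  per-row CHECK of the tabled `xS`, not an assumption;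
* `flexCriterion_deriv`: the underlying one-variable identity `f′(x)² − 2·f(x)·f″(x) = −16·Ψ₃(x)`
  for `f = 4x³ + b₂x² + 2b₄x + b₆` (`f′ = 12x² + 2b₂x + 2b₄`, `f″ = 24x + 2b₂`), from which
  `flexCriterion_disc` is the scaled instance (`B = 4f′(x₀)`, `A = f″(x₀)/2`, `C = 16 f(x₀)`);
* `flexCriterion_square`: if `B² = 4AC` and `2A·e = 1` (i.e. `2A` is a unit, `e` its inverse — over
  `ℚ` this is `A ≠ 0`, the `j ≠ 0` branch of the engine) then
  `X³ + AX² + BX + C = X³ + A·(X + B·e)²`, the Cohen–Pazuki shape with `T = (−B·e, ·)` moved to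
  `X = −B e`; and `flexCriterion_jzero`: if `A = 0` then `B² = 4AC` forces `B² = 0` (the engine's
  `j = 0` branch reads `Y² = X³ + C`).

Nothing here uses a property of `ℚ`; `R` is any commutative ring and `W` any Weierstrass curve over
it. Companion file: `SecondDescent/PhiCoveringFlexNorm.lean` (the bridge identities AFTER the
model step). References for context only (no statement of theirs is restated as a fact):
H. Cohen, F. Pazuki, Acta Arith. 140 (2009) §1.2, Lemma 1.2 (the model `y² = x³ + D(ax+b)²`);
J. H. Silverman, AEC, Ex. 3.7 (division polynomials; Mathlib `WeierstrassCurve.Ψ₃`).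
-/

namespace Summit.BirchSwinnertonDyer.Rank1Residual.SecondDescent.PhiCovering

variable {R : Type*} [CommRing R] (W : WeierstrassCurve R)

/-- Square completion: `(2y + a₁x + a₃)² − (4x³ + b₂x² + 2b₄x + b₆)` is `4` times the Weierstrass
equation residual `y² + a₁xy + a₃y − (x³ + a₂x² + a₄x + a₆)`; so on the curve
`(2y + a₁x + a₃)² = 4x³ + b₂x² + 2b₄x + b₆`. [folklore] -/
theorem flexCriterion_sub (x y : R) :
    (2 * y + W.a₁ * x + W.a₃) ^ 2 - (4 * x ^ 3 + W.b₂ * x ^ 2 + 2 * W.b₄ * x + W.b₆)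
      = 4 * (y ^ 2 + W.a₁ * x * y + W.a₃ * y - (x ^ 3 + W.a₂ * x ^ 2 + W.a₄ * x + W.a₆)) := by
  simp only [WeierstrassCurve.b₂, WeierstrassCurve.b₄, WeierstrassCurve.b₆]
  ring

/-- The scaled-and-shifted model: with `X = 4x − 4x₀` and the Taylor coefficients
`A = 12x₀ + b₂`, `B = 48x₀² + 8b₂x₀ + 8b₄`, `C = 64x₀³ + 16b₂x₀² + 32b₄x₀ + 16b₆` one has
`16·(4x³ + b₂x² + 2b₄x + b₆) = X³ + AX² + BX + C` identically (so `Y = 4(2y + a₁x + a₃)` satisfies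
`Y² = X³ + AX² + BX + C` on the curve, by `flexCriterion_sub`). [folklore] -/
theorem flexCriterion_shift (x₀ x : R) :
    16 * (4 * x ^ 3 + W.b₂ * x ^ 2 + 2 * W.b₄ * x + W.b₆)
      = (4 * x - 4 * x₀) ^ 3 + (12 * x₀ + W.b₂) * (4 * x - 4 * x₀) ^ 2
        + (48 * x₀ ^ 2 + 8 * W.b₂ * x₀ + 8 * W.b₄) * (4 * x - 4 * x₀)
        + (64 * x₀ ^ 3 + 16 * W.b₂ * x₀ ^ 2 + 32 * W.b₄ * x₀ + 16 * W.b₆) := by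
  ring

/-- The one-variable identity behind the flex criterion: for `f = 4x³ + b₂x² + 2b₄x + b₆`,
`f′(x)² − 2 f(x) f″(x) = −16 · Ψ₃(x)` with `Ψ₃ = 3x⁴ + b₂x³ + 3b₄x² + 3b₆x + b₈` Mathlib's
`3`-division polynomial (the constant term works out by `4b₈ = b₂b₆ − b₄²`, here by unfolding every
`bᵢ` to the `aᵢ`). [folklore] -/
theorem flexCriterion_deriv (x : R) :
    (12 * x ^ 2 + 2 * W.b₂ * x + 2 * W.b₄) ^ 2
      - 2 * (4 * x ^ 3 + W.b₂ * x ^ 2 + 2 * W.b₄ * x + W.b₆) * (24 * x + 2 * W.b₂)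
      = -16 * W.Ψ₃.eval x := by
  simp only [WeierstrassCurve.Ψ₃, WeierstrassCurve.b₂, WeierstrassCurve.b₄, WeierstrassCurve.b₆,
    WeierstrassCurve.b₈, Polynomial.eval_add, Polynomial.eval_mul, Polynomial.eval_pow,
    Polynomial.eval_C, Polynomial.eval_X, Polynomial.eval_ofNat]
  ring

/-- **The flex criterion.** For the shifted monic model `X³ + AX² + BX + C` of
`flexCriterion_shift`, `B² − 4AC = −256 · Ψ₃(x₀)`: the `phisel3` engine's per-row assertion
`B² = 4AC` holds exactly when the tabled shift abscissa `x₀` is a zero of the `3`-division polynomial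
(the abscissa of a point of order `3`; for a rational `3`-isogeny, of its kernel). [folklore] -/
theorem flexCriterion_disc (x₀ : R) :
    (48 * x₀ ^ 2 + 8 * W.b₂ * x₀ + 8 * W.b₄) ^ 2
      - 4 * (12 * x₀ + W.b₂) * (64 * x₀ ^ 3 + 16 * W.b₂ * x₀ ^ 2 + 32 * W.b₄ * x₀ + 16 * W.b₆)
      = -256 * W.Ψ₃.eval x₀ := by
  linear_combination (16 : R) * flexCriterion_deriv W x₀

/-- Consequently the assertion `B² = 4AC` is EQUIVALENT to `256 · Ψ₃(x₀) = 0` (over `ℚ`, to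
`Ψ₃(x₀) = 0`). [folklore] -/
theorem flexCriterion_iff (x₀ : R) :
    (48 * x₀ ^ 2 + 8 * W.b₂ * x₀ + 8 * W.b₄) ^ 2
        = 4 * (12 * x₀ + W.b₂) * (64 * x₀ ^ 3 + 16 * W.b₂ * x₀ ^ 2 + 32 * W.b₄ * x₀ + 16 * W.b₆)
      ↔ 256 * W.Ψ₃.eval x₀ = 0 := by
  have h := flexCriterion_disc W x₀
  constructor
  · intro hBAC
    linear_combination h - hBAC
  · intro hΨ
    linear_combination h - hΨ

/-- The Cohen–Pazuki shape from the flex condition (the engine's `j ≠ 0` branch): if `B² = 4AC` and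
`2A` is a unit with inverse `e` (`2·A·e = 1`), then `X³ + AX² + BX + C = X³ + A·(X + B·e)²`
identically in `X` — i.e. the model is `Y² = X³ + A(X + Be)²`, of the form `y² = x³ + D(ax + b)²`
once `A = D·a′²` is split off (`a = a′`, `b = a′·B·e`). [folklore] -/
theorem flexCriterion_square (A B C e X : R) (hBAC : B ^ 2 = 4 * A * C) (he : 2 * A * e = 1) :
    X ^ 3 + A * X ^ 2 + B * X + C = X ^ 3 + A * (X + B * e) ^ 2 := by
  -- `A (X + Be)² = A X² + 2ABe·X + A B² e²`; `2ABe = B` by `he`; `A B² e² = 4A²C e² = C (2Ae)² = C`.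
  have h1 : 2 * A * B * e = B := by linear_combination B * he
  have h2 : A * B ^ 2 * e ^ 2 = C := by
    linear_combination A * e ^ 2 * hBAC + C * (2 * A * e + 1) * he
  linear_combination (-(X : R)) * h1 - h2

/-- The engine's `j = 0` branch: if `A = 0` then the flex condition `B² = 4AC` forces `B² = 0`
(so over a field `B = 0` and the model is `Y² = X³ + C`). [folklore] -/
theorem flexCriterion_jzero (A B C : R) (hBAC : B ^ 2 = 4 * A * C) (hA : A = 0) : B ^ 2 = 0 := by
  rw [hBAC, hA]; ring

end Summit.BirchSwinnertonDyer.Rank1Residual.SecondDescent.PhiCovering
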